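import Summits.ABC.IUTFork.DAGTopM
import Summits.ABC.IUTFork.Thm311LinkLattice

/-!
# Kernel DAG index — layer C312, part j: the licence apex with Theorem 3.11 (iii) CONSTRUCTED (c312-1 file J)

index v1 · abc-iut-c312-2 (filer) per HOME/plan/KERNEL-DAG-SPEC.md v1.3 §4 (3). APPEND-ONLY (a new apex; nothing redefined).

THIS FILE PROVES NOTHING NEW AND ASSERTS NOTHING. With c312-1's file J `Thm311LinkLattice` (LANDED p408087): for a full situation
whose (iii)-objects `link : LinkData` satisfy (iii)(c), (iii)(d) AS TYPED — which J PROVES for every link built by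
`LinkData.ofFunctors` / `ofBiCoric` / `ofDiagram` (`ofFunctors_partIIIc`, `ofFunctors_partIIId`: equivariance of the Kummer
isomorphism = a naturality square; a functorial image of a FULL poly-isomorphism is stabilized) — the typed statement of Theorem 3.11
reduces to (i) ∧ (ii) (`FullSituation.statement_iff_partI_partII_of_link`). `summit_of_cor312_M_licence2` is
`DAGTopM.summit_of_cor312_M` with the licence supplied from: `hI : PartI`, `hII : PartII` (Theorem 3.11 (i), (ii) as the author
states them, typed by c312-1 B/C), `hc`, `hd` ((iii)(c)(d) as typed — theorems for constructed links), and `hLicOfThm : Statement →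
componentwise QSubHull` (THAT Theorem 3.11 licenses Step (xi-f): affirmed [IUTchIII] p. 184, denied Scholze–Stix §2.2, replaced by
(9-1) in LANA §9). kernel_hyps = 11 (hInd, hc, hd, hadm, hreal, hqreal, hI, hII, hLicOfThm, hΘ, hq), of which hc, hd are discharged by
J for constructed links and exactly one — hLicOfThm — is the disputed inference. HONEST FRAMING: nothing here asserts that abc is proved
or refuted or takes a side on Cor. 3.12. typed ≠ discharged; indexed ≠ endorsed. [claim: Mochizuki2012, status: disputed]
-/

noncomputable section

namespace Summit.ABC.IUTFork.DAG

open Cor312Proof Thm311 CategoryTheory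
open Literature.IUT.LogThetaLattice (StripFrame)

/-- **APEX — the licence form with (iii) constructed.** See the module docstring. Route by name: (`hI`, `hII`, `hc`, `hd`) ⟹ c312-1 J
`statement_iff_partI_partII_of_link` ⟹ `(S P).Statement` ⟹ (`hLicOfThm`) componentwise `QSubHull` ⟹ `DAGTopM.summit_of_cor312_M`.
[claim: Mochizuki2012, status: disputed] -/
theorem summit_of_cor312_M_licence2 (V : HeightFamily) (Tm : Thm110Family V) (A : AbcDictionary V)
    (hInd : MochizukiIndeterminacies Tm) {TI : V.Pt → ThetaIndex} (S : ∀ P, FullSituation (TI P))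
    (hc : ∀ P, (S P).link.PartIIIc) (hd : ∀ P, (S P).link.PartIIId)
    (Pn : ∀ P, PilotNouns (S P).toLatticeSituation) (n m : ℤ)
    (hadm : ∀ P (j : (TI P).LabelStar) (vQ : (TI P).VQ), (Pn P).ComponentAdm n m j vQ)
    (hreal : ∀ P, (Pn P).NegLogThetaReal n m) (hqreal : ∀ P, (Pn P).NegLogQReal n m)
    (hI : ∀ P, (S P).PartI) (hII : ∀ P, (S P).toLatticeSituation.PartII)
    (hLicOfThm : ∀ P, (S P).Statement → ∀ (j : (TI P).LabelStar) (vQ : (TI P).VQ),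
      ((Pn P).toCor312Setting n m j vQ (hadm P j vQ)).QSubHull)
    (hΘ : ∀ P, (Pn P).negLogTheta n m = (Tm.X P).negLogTheta) (hq : ∀ P, (Pn P).negLogQ n m = -(Tm.X P).absLogq) :
    _root_.ABC :=
  summit_of_cor312_M V Tm A hInd (fun P => (S P).toLatticeSituation) Pn n m hadm hreal hqreal
    (fun P j vQ => hLicOfThm P (((S P).statement_iff_partI_partII_of_link (hc P) (hd P)).2 ⟨hI P, hII P⟩) j vQ) hΘ hq

/-- The (iii)(c)(d) hypotheses of `summit_of_cor312_M_licence2` ARE theorems when the link is CONSTRUCTED by c312-1 J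
`LinkData.ofFunctors` (recorded by name; the functor arguments are J's). [claim: Mochizuki2012, status: disputed] -/
theorem licence2_hc_hd_of_ofFunctors {F : StripFrame.{0}} (H : ℤ × ℤ → F.HT) (Dl : ℤ → F.DHT)
    (ξ : ∀ n m : ℤ, F.htToD.obj (H (n, m)) ≅ Dl n) (Ffr : F.HT ⥤ F.Fxm) (Fet : F.DHT ⥤ F.Fxm)
    (kum : Ffr ≅ F.htToD ⋙ Fet) (Fenv : F.DHT ⥤ F.Fxm) (nat : Fet ≅ Fenv)
    {Rad : Type} [Category.{0} Rad] (FR : F.DHT ⥤ Rad) {Kap : Type} [Category.{0} Kap]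
    (FM : F.DHT ⥤ Kap) :
    (LinkData.ofFunctors H Dl ξ Ffr Fet kum Fenv nat FR FM).PartIIIc ∧
      (LinkData.ofFunctors H Dl ξ Ffr Fet kum Fenv nat FR FM).PartIIId :=
  ⟨LinkData.ofFunctors_partIIIc H Dl ξ Ffr Fet kum Fenv nat FR FM, LinkData.ofFunctors_partIIId H Dl ξ Ffr Fet kum Fenv nat FR FM⟩

end Summit.ABC.IUTFork.DAG

end
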